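import Summits.ABC.IUTFork.Cor312VolumesPadicSummandsM
import Literature.IUT.LogVolume.InitialThetaDataVolume
import Literature.IUT.LogVolume.GenuineLogThetaIdeles
import Literature.NumberTheory.GaloisRepresentations.PadicAlgebraDegreeOnePlace
import HarnessLib

/-!
# [IUTchIII] Corollary 3.12, statement — the Dupuy–Hilado PILOT IDELES READ OFF A GENUINE Θ-VOLUME INPUT at the
# `p`-adic presentation of the M-level log-shell signature (G1-Θ unit P4a of
# `HOME/staging/w5/w5-d166/g4/G1-THETA-SHAPES.md`: the idele read-off layer under P4 `Cor312PilotIdelesM`)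

Record-only file (D-0012) of the abc-iut cell (seat abc-iut-w5-d033, gen 9; branch C «abc ⇐ S», C-lead ruling
C-R12 (e) «target #2′: the M-level (V̲, K_{v̲}) real volume setting»). TAKES NO SIDE on [IUTchIII] Cor. 3.12.

abc-iut-w5-d166's `Real.padicPresentationOfInitialDH D p u hu` (`Cor312VolumesPadicSummandsM`, unit P1) presents
the M-level Dupuy–Hilado signature over the fibre of `V̲ → V_ℚ` at a nonarchimedean rational place `u ∋ p` with the
fields `kOfM D p u hu x = RescaledCompletion K p 𝔭_{w(x)}` — the rescaled completion of `K` at the place `w(x) ∈ V̲`.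
abc-iut-S2's GENUINE Θ-volume input `I : ThetaVolumeInput (fieldOfModuli E) K` (`GenuineLogTheta`) carries its
ideles `t_{Θ,j,v}`, `t_{q,v}` as units of `((placeSection D).localFields p).k v = RescaledCompletion K p v̲`,
`v̲ = liftPlace D v`, indexed by `v ∈ V(F_mod)_p` (`CompletionLocalFields`, `InitialThetaDataVolume`). The sharp
Θ-boxes and the `q`-centre of the M-level setting (unit P4, abc-iut-s2-p8) are these ideles acting on the summands
of the presentation; THIS file is the read-off layer between the two indexings:

* §1 THE INDEX IDENTIFICATION `V̲_u ≅ V(F_mod)_p`: for `x` in the fibre, `toVMod x = v(x) := placeModOfM D u x`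
  (`toVMod_val_eq_non_placeModOfM`), `v(x) ∈ V(F_mod)_p` (`placeModOfM_mem_placesOver`), `x = underline v(x)`
  (`underline_placeModOfM`), **`liftPlace D v(x) = 𝔭_{w(x)}`** (`liftPlace_placeModOfM`: the section place OVER the
  place of `F_mod` under `w(x)` IS `w(x)`, since `V̲ ⥲ V_mod` is a bijection, [IUTchI] Def. 3.1 (e)), and the
  bijection **`fibreEquivPlacesOverM : Fibre (Val.non u) ≃ placesOver (fieldOfModuli E) p`** (P6's index
  identification "`v̲ ↔ v ∈ V(F_mod)_p`");
* §2 THE ONE DEPENDENT CAST of the β port: `PlaceCast.castOfEq` along an equality of places, a ring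
  isomorphism preserving the norm (`norm_castOfEq`);
* §3 THE IDELES AT THE PRESENTATION: `tThetaM D r p u hu i x`, `tqM D r p u hu i x : kOfM D p u hu x` for idele data
  `r : ThetaData.IdeleData D` (every volume input `I` of `D` is `volumeInputOf D r`, S2's `exists_eq_volumeInputOf`;
  `ideleDataOf` chooses it), with abc-iut-c312-7's idele side conditions AS THEOREMS: non-zero
  (`tThetaM_ne_zero`, `tqM_ne_zero`: units), Dupuy–Hilado's realisation identity (3.4)
  `log ‖t_{Θ,i+1,v}‖ = −P_{Θ,i+1}(v)·ln|κ(v)|/n_v` (`log_norm_tThetaM`, `log_norm_tqM`: the input's `tΘ_ord`/`tq_ord`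
  through S2's `LocalFields.log_norm_eq_neg_ordv`), and norm `1` off `V^bad_mod` (`norm_tThetaM_eq_one_of_not_mem`,
  `norm_tqM_eq_one_of_not_mem`) — c312-7's binders `ht0`/`ht1`/`ht`/`htq0`/`htq1`/`htq` of `Cor312PilotIdelesPr`
  discharged at the M level, as the SHAPES §5 P4 says ("no side condition survives").

[cite: Mochizuki2012, IUTchI Def. 3.1 (e) p. 62] [cite: DupuyHilado2025, Def. 3.6.1, §3.4, §3.9]
[claim: Mochizuki2012, status: disputed] for the quoted setting. HONEST FRAMING: bookkeeping over OUR typed objects;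
nothing here bears on the truth of [IUTchIII] Cor. 3.12; typed ≠ proved; instantiated ≠ endorsed.
Deliberately NOT here: the boxes, the `q`-centre, the setting (unit P4), the containers/frames (P2/P3), any judgement.
-/

noncomputable section

open Set Function NumberField IsDedekindDomain
open scoped Pointwise

/-! ## §2 (stated first, field-generic). Transport of the rescaled completion along an equality of places -/

namespace Summit.ABC.IUTFork.Thm311.Real.PlaceCast

open Literature.NumberTheory.NumberFields

variable {K : Type} [Field K] [NumberField K] {p : ℕ}
  {v₁ v₂ : HeightOneSpectrum (𝓞 K)} (e : v₁ = v₂)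
  (h₁ : ((p : ℕ) : 𝓞 K) ∈ v₁.asIdeal) (h₂ : ((p : ℕ) : 𝓞 K) ∈ v₂.asIdeal)

/-- **Transport of `K_{v}` along an equality of places** `v₁ = v₂`: the identity, as a ring isomorphism
`RescaledCompletion K p v₁ ≃+* RescaledCompletion K p v₂` (the proof arguments `p ∈ 𝔭` are irrelevant). [folklore] -/
def castOfEq : RescaledCompletion K p v₁ h₁ ≃+* RescaledCompletion K p v₂ h₂ := by
  subst e
  exact RingEquiv.refl _

/-- Along `rfl` the transport is the identity. [folklore] -/
@[simp] theorem castOfEq_rfl (h₁' : ((p : ℕ) : 𝓞 K) ∈ v₁.asIdeal) (x : RescaledCompletion K p v₁ h₁) :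
    castOfEq (p := p) rfl h₁ h₁' x = x := rfl

/-- The transport preserves the (rescaled) norm. [folklore] -/
@[simp] theorem norm_castOfEq (x : RescaledCompletion K p v₁ h₁) : ‖castOfEq e h₁ h₂ x‖ = ‖x‖ := by
  subst e
  rfl

/-- The transport of a non-zero element is non-zero. [folklore] -/
theorem castOfEq_ne_zero {x : RescaledCompletion K p v₁ h₁} (hx : x ≠ 0) : castOfEq e h₁ h₂ x ≠ 0 :=
  (map_ne_zero_iff _ (castOfEq e h₁ h₂).injective).mpr hx

end Summit.ABC.IUTFork.Thm311.Real.PlaceCast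

namespace Summit.ABC.IUTFork.Thm311.Real

open Cor312Vol Literature.IUT.LogThetaLattice Literature.IUT.LogVolume Literature.IUT.HodgeTheaters
  Literature.NumberTheory.NumberFields

variable {F K Fbar : Type} [Field F] [NumberField F] [Field K] [NumberField K] [Algebra F K]
  [Field Fbar] [Algebra F Fbar] [Algebra K Fbar] {E : WeierstrassCurve F} [E.IsElliptic] {l : ℕ}
  {Pb : BadPlacePredicates K} (D : InitialThetaData F K Fbar E l Pb)
  (p : ℕ) [hp : Fact p.Prime] (u : FinitePlace ℚ) (hu : ((p : ℕ) : 𝓞 ℚ) ∈ (FinitePlace.maximalIdeal u).asIdeal)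

/-! ## §1. The index identification `V̲_u ≅ V(F_mod)_p` -/

/-- `toVMod` of a nonarchimedean valuation of `K` is the finite place of the prime of `𝓞_{F_mod}` below it (two
restrictions, `Ideal.under_under` not even needed: this is the definition). [folklore] -/
theorem toVMod_non (w : FinitePlace K) :
    toVMod F K E (Val.non w) =
      Val.non (FinitePlace.mk (((FinitePlace.maximalIdeal w).under (𝓞 F)).under (𝓞 (fieldOfModuli E)))) := by
  show Val.restrict (fieldOfModuli E) (Val.restrict F (Val.non w)) = _
  rw [restrict_non, restrict_non, FinitePlace.maximalIdeal_mk]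

/-- **`toVMod x = v(x)`**: the place of `V_mod` under the member `x` of the fibre is (the finite place of)
`placeModOfM D u x`. [cite: Mochizuki2012, IUTchI Def. 3.1 (e) p. 62] -/
theorem toVMod_val_eq_non_placeModOfM (x : (thetaIndexOfInitial D).Fibre (Val.non u)) :
    toVMod F K E (Subtype.val (Subtype.val x) : Val K) = Val.non (FinitePlace.mk (placeModOfM D u x)) := by
  rw [val_eq_non_finitePlaceOfM D u x, toVMod_non]
  rfl

/-- **`x = v̲(x)`**: the member `x ∈ V̲` of the fibre IS the section value `underline` at the place `v(x)` of `F_mod`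
under it (`V̲ ⥲ V_mod` is injective on `V̲`, [IUTchI] Def. 3.1 (e)). [cite: Mochizuki2012, IUTchI Def. 3.1 (e) p. 62] -/
theorem underline_placeModOfM (x : (thetaIndexOfInitial D).Fibre (Val.non u)) :
    D.underline (Val.non (FinitePlace.mk (placeModOfM D u x))) = (Subtype.val (Subtype.val x) : Val K) :=
  D.V_bijOn.injOn (D.underline_mem _) x.1.2
    (by rw [D.toVMod_underline, toVMod_val_eq_non_placeModOfM])

/-- **`liftPlace D v(x) = 𝔭_{w(x)}`**: the section place of `D` over the place of `F_mod` under `w(x)` IS `w(x)` — the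
two indexings of the genuine completions (abc-iut-S2's by `v ∈ V(F_mod)`, P1's by `x ∈ V̲_u`) name THE SAME place
of `K`. [cite: Mochizuki2012, IUTchI Def. 3.1 (e) p. 62] -/
theorem liftPlace_placeModOfM (x : (thetaIndexOfInitial D).Fibre (Val.non u)) :
    ThetaData.liftPlace D (placeModOfM D u x) = placeOfM D u x := by
  have h := ThetaData.underline_eq_non_liftPlace D (placeModOfM D u x)
  rw [underline_placeModOfM, val_eq_non_finitePlaceOfM D u x] at h
  have h' : FinitePlace.mk (ThetaData.liftPlace D (placeModOfM D u x)) = finitePlaceOfM D u x :=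
    (Sum.inr_injective h).symm
  have h'' := congrArg FinitePlace.maximalIdeal h'
  rw [FinitePlace.maximalIdeal_mk] at h''
  exact h''

/-- The same for S2's `placeSection D` (whose `lift` is `liftPlace`). [cite: Mochizuki2012, IUTchI Def. 3.1 (e) p. 62] -/
theorem placeSection_lift_placeModOfM (x : (thetaIndexOfInitial D).Fibre (Val.non u)) :
    (ThetaData.placeSection D).lift (placeModOfM D u x) = placeOfM D u x :=
  liftPlace_placeModOfM D u x

include hu in
/-- **`v(x) ∈ V(F_mod)_p`**: the place of `F_mod` under a member of the fibre over `u ∋ p` lies over `p`.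
[cite: NeukirchANT1999, Ch. I §8] -/
theorem placeModOfM_mem_placesOver (x : (thetaIndexOfInitial D).Fibre (Val.non u)) :
    placeModOfM D u x ∈ placesOver (fieldOfModuli E) p := by
  rw [mem_placesOver_iff]
  have h := (mem_placesOver_iff (placeOfM D u x)).mp (placeOfM_mem_placesOver D p u hu x)
  constructor
  rw [h.over]
  show (placeOfM D u x).asIdeal.under ℤ =
    ((((placeOfM D u x).asIdeal.under (𝓞 F)).under (𝓞 (fieldOfModuli E))).under ℤ)
  rw [Ideal.under_under, Ideal.under_under]

/-- The member of the fibre, read as a place of `F_mod` over `p`. [cite: Mochizuki2012, IUTchI Def. 3.1 (e) p. 62] -/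
def placeOverOfFibreM (x : (thetaIndexOfInitial D).Fibre (Val.non u)) : placesOver (fieldOfModuli E) p :=
  ⟨placeModOfM D u x, placeModOfM_mem_placesOver D p u hu x⟩

/-- Its underlying place is `placeModOfM`. [folklore] -/
@[simp] theorem placeOverOfFibreM_val (x : (thetaIndexOfInitial D).Fibre (Val.non u)) :
    (placeOverOfFibreM D p u hu x).1 = placeModOfM D u x := rfl

omit hp in
/-- Two finite places of `ℚ` containing the same rational prime coincide (`V(ℚ)^non ≅ primes`, Mathlib's
`Rat.HeightOneSpectrum.primesEquiv`). [folklore] -/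
theorem heightOneSpectrum_rat_eq_of_natCast_mem [Fact p.Prime] {a b : HeightOneSpectrum (𝓞 ℚ)}
    (ha : ((p : ℕ) : 𝓞 ℚ) ∈ a.asIdeal) (hb : ((p : ℕ) : 𝓞 ℚ) ∈ b.asIdeal) : a = b := by
  apply Rat.HeightOneSpectrum.primesEquiv.injective
  apply Subtype.ext
  rw [Literature.NumberTheory.GaloisRepresentations.LocalField.primesEquiv_eq_of_natCast_mem p a ha,
    Literature.NumberTheory.GaloisRepresentations.LocalField.primesEquiv_eq_of_natCast_mem p b hb]

omit hp in
/-- A place of `F_mod` over `p` contains `p`. [folklore] -/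
theorem natCast_mem_of_mem_placesOver [Fact p.Prime] (v : placesOver (fieldOfModuli E) p) :
    ((p : ℕ) : 𝓞 (fieldOfModuli E)) ∈ v.1.asIdeal := by
  have h := (mem_placesOver_iff v.1).mp v.2
  have hmem : (p : ℤ) ∈ v.1.asIdeal.under ℤ := by
    rw [← h.over]; exact Ideal.mem_span_singleton_self _
  simpa using Ideal.mem_comap.mp hmem

include hu in
/-- The place of `ℚ` under a place `v ∈ V(F_mod)_p` is `u` (both contain `p`). [folklore] -/
theorem under_rat_eq_maximalIdeal (v : placesOver (fieldOfModuli E) p) :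
    v.1.under (𝓞 ℚ) = FinitePlace.maximalIdeal u := by
  refine heightOneSpectrum_rat_eq_of_natCast_mem p ?_ hu
  have : algebraMap (𝓞 ℚ) (𝓞 (fieldOfModuli E)) ((p : ℕ) : 𝓞 ℚ) ∈ v.1.asIdeal := by
    simpa using natCast_mem_of_mem_placesOver (E := E) p v
  exact Ideal.mem_comap.mpr this

include hu in
/-- The section value `v̲ = underline v` over `v ∈ V(F_mod)_p` lies over `u`. [cite: Mochizuki2012, IUTchI Def. 3.1 (e) p. 62] -/
theorem underQ_underline_eq (v : placesOver (fieldOfModuli E) p) :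
    (thetaIndexOfInitial D).over ⟨D.underline (Val.non (FinitePlace.mk v.1)), D.underline_mem _⟩ = Val.non u := by
  show Val.restrict ℚ (toVMod F K E (D.underline (Val.non (FinitePlace.mk v.1)))) = Val.non u
  rw [D.toVMod_underline, restrict_non, FinitePlace.maximalIdeal_mk, under_rat_eq_maximalIdeal p u hu v,
    FinitePlace.mk_maximalIdeal]

/-- **The member of `V̲_u` over a place `v ∈ V(F_mod)_p`**: the section value `v̲ = underline v`, which lies over
`u` (the place of `ℚ` under `v` contains `p`, hence is `u`). [cite: Mochizuki2012, IUTchI Def. 3.1 (e) p. 62] -/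
def fibreOfPlaceOverM (v : placesOver (fieldOfModuli E) p) : (thetaIndexOfInitial D).Fibre (Val.non u) :=
  ⟨⟨D.underline (Val.non (FinitePlace.mk v.1)), D.underline_mem _⟩, underQ_underline_eq D p u hu v⟩

include hu in
/-- `placeModOfM` of the member over `v` is `v` (`v̲ ∩ 𝓞_{F_mod} = v`). [cite: Mochizuki2012, IUTchI Def. 3.1 (e) p. 62] -/
theorem placeModOfM_fibreOfPlaceOverM (v : placesOver (fieldOfModuli E) p) :
    placeModOfM D u (fibreOfPlaceOverM D p u hu v) = v.1 := by
  have h := toVMod_val_eq_non_placeModOfM D u (fibreOfPlaceOverM D p u hu v)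
  have h2 : toVMod F K E (Subtype.val (Subtype.val (fibreOfPlaceOverM D p u hu v)) : Val K) =
      Val.non (FinitePlace.mk v.1) := D.toVMod_underline _
  rw [h2] at h
  have h3 := congrArg FinitePlace.maximalIdeal (Sum.inr_injective h)
  rw [FinitePlace.maximalIdeal_mk, FinitePlace.maximalIdeal_mk] at h3
  exact h3.symm

include hu in
/-- **THE INDEX IDENTIFICATION `V̲_u ≅ V(F_mod)_p`** (unit P6's "`v̲ ↔ v ∈ V(F_mod)_p`"): members of the fibre of
`V̲ → V_ℚ` over `u ∋ p` correspond to the places of `F_mod` over `p`, by `x ↦ v(x)` / `v ↦ v̲`.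
[cite: Mochizuki2012, IUTchI Def. 3.1 (e) p. 62] -/
def fibreEquivPlacesOverM : (thetaIndexOfInitial D).Fibre (Val.non u) ≃ placesOver (fieldOfModuli E) p where
  toFun := placeOverOfFibreM D p u hu
  invFun := fibreOfPlaceOverM D p u hu
  left_inv x := by
    apply Subtype.ext; apply Subtype.ext
    exact underline_placeModOfM D u x
  right_inv v := Subtype.ext (placeModOfM_fibreOfPlaceOverM D p u hu v)

/-! ## §3. The ideles of a genuine Θ-volume input at the presentation -/

section Ideles

variable (r : ThetaData.IdeleData D)

/-- **The Θ-idele at the presentation**: `t_{Θ,i+1,v(x)} ∈ K_{v̲(x)} = kOfM D p u hu x`, read off the idele data `r`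
of `D` at the place `v(x) ∈ V(F_mod)_p` under `x` and transported along `liftPlace D v(x) = 𝔭_{w(x)}` (§1, §2).
[cite: DupuyHilado2025, §3.9] -/
def tThetaM (i : Fin (thetaIndexOfInitial D).lstar) (x : (thetaIndexOfInitial D).Fibre (Val.non u)) :
    kOfM D p u hu x :=
  PlaceCast.castOfEq (placeSection_lift_placeModOfM D u x)
    ((ThetaData.placeSection D).natCast_mem_lift (placeOverOfFibreM D p u hu x)) (natCast_mem_placeOfM D p u hu x)
    ((r.tΘ p hp.out i (placeOverOfFibreM D p u hu x) :
      (((ThetaData.placeSection D).localFieldFamily p hp.out).k (placeOverOfFibreM D p u hu x))ˣ) :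
        ((ThetaData.placeSection D).localFieldFamily p hp.out).k (placeOverOfFibreM D p u hu x))

/-- The procession index `1` (as `0 : Fin ℓ⋇`; `ℓ⋇ ≥ 2`), at which the label-free `q`-idele is read (the input carries
a `q`-idele in every procession degree, all with the same valuation `P_q(v)`). [folklore] -/
def firstIdx : Fin (thetaIndexOfInitial D).lstar :=
  ⟨0, by have h := (thetaIndexOfInitial D).two_le_lstar; omega⟩

/-- **The `q`-idele at the presentation**: `t_{q,v(x)} ∈ K_{v̲(x)} = kOfM D p u hu x` (label-free, as abc-iut-c312-7's
`tq`; read in the first procession degree), transported along `liftPlace D v(x) = 𝔭_{w(x)}`. [cite: DupuyHilado2025, §3.9] -/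
def tqM (x : (thetaIndexOfInitial D).Fibre (Val.non u)) : kOfM D p u hu x :=
  PlaceCast.castOfEq (placeSection_lift_placeModOfM D u x)
    ((ThetaData.placeSection D).natCast_mem_lift (placeOverOfFibreM D p u hu x)) (natCast_mem_placeOfM D p u hu x)
    ((r.tq p hp.out (firstIdx D) (placeOverOfFibreM D p u hu x) :
      (((ThetaData.placeSection D).localFieldFamily p hp.out).k (placeOverOfFibreM D p u hu x))ˣ) :
        ((ThetaData.placeSection D).localFieldFamily p hp.out).k (placeOverOfFibreM D p u hu x))

/-- **`ht0` PROVED at the M level**: the Θ-idele is non-zero (a unit). [folklore] -/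
theorem tThetaM_ne_zero (i : Fin (thetaIndexOfInitial D).lstar) (x : (thetaIndexOfInitial D).Fibre (Val.non u)) :
    tThetaM D p u hu r i x ≠ 0 :=
  PlaceCast.castOfEq_ne_zero _ _ _ (Units.ne_zero _)

/-- **`htq0` PROVED at the M level**: the `q`-idele is non-zero (a unit). [folklore] -/
theorem tqM_ne_zero (x : (thetaIndexOfInitial D).Fibre (Val.non u)) : tqM D p u hu r x ≠ 0 :=
  PlaceCast.castOfEq_ne_zero _ _ _ (Units.ne_zero _)

/-- The norm of the Θ-idele at the presentation is the norm of the input's idele. [folklore] -/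
theorem norm_tThetaM (i : Fin (thetaIndexOfInitial D).lstar) (x : (thetaIndexOfInitial D).Fibre (Val.non u)) :
    ‖tThetaM D p u hu r i x‖ =
      ‖((r.tΘ p hp.out i (placeOverOfFibreM D p u hu x) :
        (((ThetaData.placeSection D).localFieldFamily p hp.out).k (placeOverOfFibreM D p u hu x))ˣ) :
          ((ThetaData.placeSection D).localFieldFamily p hp.out).k (placeOverOfFibreM D p u hu x))‖ :=
  PlaceCast.norm_castOfEq _ _ _ _

/-- The norm of the `q`-idele at the presentation is the norm of the input's idele. [folklore] -/
theorem norm_tqM (x : (thetaIndexOfInitial D).Fibre (Val.non u)) :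
    ‖tqM D p u hu r x‖ =
      ‖((r.tq p hp.out (firstIdx D) (placeOverOfFibreM D p u hu x) :
        (((ThetaData.placeSection D).localFieldFamily p hp.out).k (placeOverOfFibreM D p u hu x))ˣ) :
          ((ThetaData.placeSection D).localFieldFamily p hp.out).k (placeOverOfFibreM D p u hu x))‖ :=
  PlaceCast.norm_castOfEq _ _ _ _

/-- **`ht` PROVED at the M level — Dupuy–Hilado (3.4) for the Θ-idele**:
`log ‖t_{Θ,i+1,v(x)}‖ = −P_{Θ,i+1}(v(x))·ln|κ(v(x))|/n_{v(x)}` with `P_Θ` the Θ-pilot divisor of `D`'s pilot data over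
`F_mod` (the input's `tΘ_ord` through S2's `LocalFields.log_norm_eq_neg_ordv`). [cite: DupuyHilado2025, §3.4, §3.9] -/
theorem log_norm_tThetaM (i : Fin (thetaIndexOfInitial D).lstar) (x : (thetaIndexOfInitial D).Fibre (Val.non u)) :
    Real.log ‖tThetaM D p u hu r i x‖ =
      -((ThetaData.pilotData D).thetaPilot i (placeModOfM D u x)) * logNorm (fieldOfModuli E) (placeModOfM D u x) /
        localDegree (fieldOfModuli E) (placeModOfM D u x) := by
  rw [norm_tThetaM, LocalFields.log_norm_eq_neg_ordv, r.tΘ_ord p hp.out i (placeOverOfFibreM D p u hu x)]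
  rfl

/-- **`htq` PROVED at the M level — Dupuy–Hilado (3.4) for the `q`-idele**:
`log ‖t_{q,v(x)}‖ = −P_q(v(x))·ln|κ(v(x))|/n_{v(x)}`. [cite: DupuyHilado2025, §3.4, §3.9] -/
theorem log_norm_tqM (x : (thetaIndexOfInitial D).Fibre (Val.non u)) :
    Real.log ‖tqM D p u hu r x‖ =
      -((ThetaData.pilotData D).qPilot (placeModOfM D u x)) * logNorm (fieldOfModuli E) (placeModOfM D u x) /
        localDegree (fieldOfModuli E) (placeModOfM D u x) := by
  rw [norm_tqM, LocalFields.log_norm_eq_neg_ordv, r.tq_ord p hp.out (firstIdx D) (placeOverOfFibreM D p u hu x)]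
  rfl

/-- **`ht1` PROVED at the M level**: off `V^bad_mod` the Θ-idele is a UNIT OF NORM `1` (`P_Θ` is supported on
`V^bad_mod`). [cite: DupuyHilado2025, §3.3, §3.4] -/
theorem norm_tThetaM_eq_one_of_not_mem (i : Fin (thetaIndexOfInitial D).lstar)
    (x : (thetaIndexOfInitial D).Fibre (Val.non u)) (hx : placeModOfM D u x ∉ (ThetaData.pilotData D).S) :
    ‖tThetaM D p u hu r i x‖ = 1 := by
  have h := log_norm_tThetaM D p u hu r i x
  rw [PilotData.thetaPilot_apply_of_not_mem (ThetaData.pilotData D) i hx, neg_zero, zero_mul, zero_div] at h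
  rcases Real.log_eq_zero.mp h with h0 | h1 | hm1
  · exact absurd (norm_eq_zero.mp h0) (tThetaM_ne_zero D p u hu r i x)
  · exact h1
  · exact absurd hm1 (by have := norm_nonneg (tThetaM D p u hu r i x); intro h'; linarith)

/-- **`htq1` PROVED at the M level**: off `V^bad_mod` the `q`-idele is a unit of norm `1` (`P_q` is supported on
`V^bad_mod`). [cite: DupuyHilado2025, §3.3, §3.4] -/
theorem norm_tqM_eq_one_of_not_mem
    (x : (thetaIndexOfInitial D).Fibre (Val.non u)) (hx : placeModOfM D u x ∉ (ThetaData.pilotData D).S) :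
    ‖tqM D p u hu r x‖ = 1 := by
  have h := log_norm_tqM D p u hu r x
  rw [PilotData.qPilot_apply_of_not_mem (ThetaData.pilotData D) hx, neg_zero, zero_mul, zero_div] at h
  rcases Real.log_eq_zero.mp h with h0 | h1 | hm1
  · exact absurd (norm_eq_zero.mp h0) (tqM_ne_zero D p u hu r x)
  · exact h1
  · exact absurd hm1 (by have := norm_nonneg (tqM D p u hu r x); intro h'; linarith)

end Ideles

/-! ## §3b. From a volume input `I` of `D` to its idele data -/

/-- The idele data carried by a volume input `I` of `D` (S2's `exists_eq_volumeInputOf`: `I = volumeInputOf D r`).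
[cite: Mochizuki2012, IUTchI Def. 3.1 p. 61–62] -/
def ideleDataOf {I : ThetaVolumeInput (fieldOfModuli E) K} (hI : ThetaData.IsVolumeInputOf D I) :
    ThetaData.IdeleData D :=
  (ThetaData.exists_eq_volumeInputOf D hI).choose

/-- `I = volumeInputOf D (ideleDataOf D hI)`. [cite: Mochizuki2012, IUTchI Def. 3.1 p. 61–62] -/
theorem eq_volumeInputOf_ideleDataOf {I : ThetaVolumeInput (fieldOfModuli E) K} (hI : ThetaData.IsVolumeInputOf D I) :
    I = ThetaData.volumeInputOf D (ideleDataOf D hI) :=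
  (ThetaData.exists_eq_volumeInputOf D hI).choose_spec

/-- Hence `−|log(Θ)|` of `I` is that of `volumeInputOf D (ideleDataOf D hI)` (so unit P6 may work with idele data
throughout). [cite: Mochizuki2012, IUTchIII Cor. 3.12 p. 173–174] -/
theorem negLogTheta_eq_ideleDataOf {I : ThetaVolumeInput (fieldOfModuli E) K} (hI : ThetaData.IsVolumeInputOf D I) :
    I.negLogTheta = (ThetaData.volumeInputOf D (ideleDataOf D hI)).negLogTheta := by
  rw [← eq_volumeInputOf_ideleDataOf D hI]

/-- … and `−|log(q)|` likewise. [cite: Mochizuki2012, IUTchIV Thm. 1.10 p. 23] -/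
theorem negAbsLogQ_eq_ideleDataOf {I : ThetaVolumeInput (fieldOfModuli E) K} (hI : ThetaData.IsVolumeInputOf D I) :
    I.negAbsLogQ = (ThetaData.volumeInputOf D (ideleDataOf D hI)).negAbsLogQ := by
  rw [← eq_volumeInputOf_ideleDataOf D hI]

end Summit.ABC.IUTFork.Thm311.Real

end
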